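import Summits.CriticalPhenomena.CardyFormulaZ2.Theorems.CardyComplexConeEdgePrecompactUFRSExteriorClosing
import Summits.CriticalPhenomena.CardyFormulaZ2.Theorems.CardyComplexConeEdgePrecompactUFRSTwoArcCore
import Summits.CriticalPhenomena.CardyFormulaZ2.Theorems.CardyComplexConeEdgePrecompactUFRSTwoArcGlue
import Literature.Probability.Percolation.FKLoopWindingCells

/-!
# The exterior winding lemma: a closed chain of inner corner darts does not wind around non-inner faces
(line `qkz-strip-boundary-arm` of crux `CardyComplexCone.EdgePrecompact`, stmt-CriticalPhenomena-11387;
second foundational input of the trail-based planar analysis of the START-pair residual, see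
`…UFRSExteriorClosing.lean` and `…UFRSStartPairReturn.lean`)

In the medial coordinates of `MedialTrailUmlaufsatz.lean` (`cpos`, `cdir`, the faces `MedialTrail.Pt`
of the oriented medial graph, the winding count `MedialTrail.dwnd` of a list of darts) the faces of the
medial lattice are the vertices AND the faces of `ℤ²`: the vertex `v` is the medial face
`vcell v = (v₀ + v₁ - 1, v₁ - v₀)`, the face with lower-left corner `f` is `fcell f = (f₀ + f₁, f₁ - f₀)`,
and the dart of the corner `(v, k)` (`cornerDart`) has `vcell v` on its left and `fcell (cFace (v, k))`
on its right (`lf_cornerDart`, `rf_cornerDart`). Across a dart `d` the winding count of a closed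
chain of unit-or-null steps jumps by the signed multiplicity of `d` (`dwnd_rf_sub_lf_ST`, from the jump
formulas `dwnd_sub_west` and `dwnd_sub_south_chain_SR`). Hence, if the chain consists of darts (and
reversed darts) of corners whose faces are INNER for a datum `E`, its winding count is the same at
`fcell f`, at `vcell v` and at `fcell f'` whenever `v` is a common vertex of the side-adjacent NON-inner
faces `f`, `f'`; following a chain of non-inner faces (`exists_faceChain_ST`, hole-freeness of the inner
faces of a Jordan datum) up to a face above every dart of the chain, where the count vanishes, gives:

* `ufrs_exteriorWinding_ST` (registered): for an admissible datum of a Jordan Dobrushin domain, a closed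
  chain of darts / reversed darts of corners with inner faces has winding count `0` at the medial face of
  every non-inner face and at the medial face of every vertex of a non-inner face.

Also here (tools of the next file `…UFRSCanonicalTurning.lean`): medial coordinates under translation
(`mshift`, `unshift`, `unshift_cpos_ST`, `turn_unshift_ST`, `unshift_step_ST`), free steps as coded darts
(`freeStep_dart_ST`), and the dart version `isTrail_glue_darts_ST` of the gluing lemma `isTrail_glue_SR`
(the closing path may touch itself; only its darts must be distinct).

This is what kills the boundary term of the two-trail comparison (`twoTrail_turn_sub_SR`) at the start
dart `a` of two explorations closed by a common exterior path: the two faces of that dart are the start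
VERTEX `a.1` (a vertex of the outer face of `e_a`) and the inner face of `e_a`, and the dart `a` itself
cancels in the difference chain.

References: H. Hopf, Compositio Math. 2 (1935); S. Smirnov, Ann. of Math. 172 (2010), §3–4.
-/

set_option linter.unusedVariables false

namespace Summit.CriticalPhenomena.CardyFormulaZ2.Cruxes.EdgePrecompact.QkzStripBoundaryArm

open MeasureTheory Filter Set Metric
open scoped Topology BigOperators Pointwise
open Literature.Probability.LatticeModels Literature.Probability.Percolation
open Literature.Probability.LatticeModels.MedialTrail
open Literature.Probability.RandomPlanarGeometry (DobrushinDomain)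
open Summit.CriticalPhenomena.CardyFormulaZ2.Theses.CardyComplexCone

noncomputable section

/-! ## The dictionary
The cells `vcell v`, `fcell f` (faces of the medial lattice at a vertex / a face of `ℤ²`), the dart
`cornerDart c` of a corner and `lf_cornerDart` / `rf_cornerDart` (vertex cell on the left, face cell on the
right) are the tree's (`Literature/Probability/Percolation/FKLoopWindingCells.lean`). -/

/-! ## The jump of the winding count across a dart -/

/-- **Jump across a dart.** For a closed chain of unit-or-null steps and a dart `p → q` of the oriented
medial graph, the winding count on the right of the dart exceeds that on its left by the number of
occurrences of the reversed dart minus that of the dart. -/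
theorem dwnd_rf_sub_lf_ST (D : List (Pt × Pt)) (hD : ∀ d ∈ D, IsUnitStep d.1 d.2 ∨ d.1 = d.2)
    (hK : ∀ g : Pt → ℤ, (D.map fun d => g d.2 - g d.1).sum = 0) (p q : Pt) (hd : IsDart p q) :
    dwnd D (rf (p, q)) - dwnd D (lf (p, q)) = D.count (q, p) - D.count (p, q) := by
  obtain ⟨x, y⟩ := p
  obtain ⟨x', y'⟩ := q
  rcases hd with ⟨hpar, hx, hy | hy⟩ | ⟨hpar, hy, hx | hx⟩ <;> simp only at hx hy hpar <;> rw [hx, hy]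
  · have h := dwnd_sub_west D x y
    simp only [lf, rf]
    split_ifs <;> omega
  · have h := dwnd_sub_west D x (y - 1)
    rw [show y - 1 + 1 = y by ring] at h
    simp only [lf, rf]
    split_ifs <;> omega
  · have h := dwnd_sub_south_chain_SR D hD hK x y
    simp only [lf, rf]
    split_ifs <;> omega
  · have h := dwnd_sub_south_chain_SR D hD hK (x - 1) y
    rw [show x - 1 + 1 = x by ring] at h
    simp only [lf, rf]
    split_ifs <;> omega

section Supported

variable {E : DiscreteDobrushin}

/-- A chain SUPPORTED ON INNER CORNERS: every element is the dart, or the reversed dart, of a corner whose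
face is inner for `E` (the inline hypothesis of `ufrs_exteriorWinding_ST`). Such chains consist of unit steps. -/
theorem unitStep_of_supported_ST {D : List (Pt × Pt)}
    (hsupp : ∀ d ∈ D, ∃ p : Site 2 × Fin 4, E.IsInnerFace (cFace p) ∧ (d = (cpos p, ((cpos p).1 + (cdir p.2).1, (cpos p).2 + (cdir p.2).2)) ∨ d = (((cpos p).1 + (cdir p.2).1, (cpos p).2 + (cdir p.2).2), cpos p))) :
    ∀ d ∈ D, IsUnitStep d.1 d.2 ∨ d.1 = d.2 := by
  intro d hd
  obtain ⟨p, -, h | h⟩ := hsupp d hd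
  · left
    have := (isDart_cornerDart p).isUnitStep
    rw [h]; exact this
  · left
    have := (isDart_cornerDart p).isUnitStep.symm
    rw [h]; exact this

/-- Across the dart of a corner with NON-inner face a supported chain does not jump: the winding counts
at the medial faces of the vertex and of the face of the corner agree. -/
theorem dwnd_vcell_eq_fcell_ST {D : List (Pt × Pt)}
    (hsupp : ∀ d ∈ D, ∃ p : Site 2 × Fin 4, E.IsInnerFace (cFace p) ∧ (d = (cpos p, ((cpos p).1 + (cdir p.2).1, (cpos p).2 + (cdir p.2).2)) ∨ d = (((cpos p).1 + (cdir p.2).1, (cpos p).2 + (cdir p.2).2), cpos p)))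
    (hK : ∀ g : Pt → ℤ, (D.map fun d => g d.2 - g d.1).sum = 0)
    (v : Site 2) (k : Fin 4) (hv : ¬ E.IsInnerFace (faceAt v k)) :
    dwnd D (vcell v) = dwnd D (fcell (faceAt v k)) := by
  have hjump := dwnd_rf_sub_lf_ST D (unitStep_of_supported_ST hsupp) hK (cornerDart (v, k)).1 (cornerDart (v, k)).2
    (isDart_cornerDart _)
  rw [Prod.mk.eta, lf_cornerDart, rf_cornerDart] at hjump
  -- neither the dart of `(v, k)` nor its reverse occurs in the chain
  have h1 : D.count (cornerDart (v, k)) = 0 := by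
    rw [List.count_eq_zero]
    intro hmem
    obtain ⟨p, hp, h | h⟩ := hsupp _ hmem
    · have : (v, k) = p := cornerDart_injective h
      exact hv (by rw [show faceAt v k = cFace (v, k) from rfl, this]; exact hp)
    · have hd := isDart_cornerDart (v, k)
      have hd' := isDart_cornerDart p
      rw [h] at hd
      exact hd'.not_swap hd
  have h2 : D.count ((cornerDart (v, k)).2, (cornerDart (v, k)).1) = 0 := by
    rw [List.count_eq_zero]
    intro hmem
    obtain ⟨p, hp, h | h⟩ := hsupp _ hmem
    · have hd := isDart_cornerDart (v, k)
      have hd' := isDart_cornerDart p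
      rw [show cornerDart p = (cpos p, ((cpos p).1 + (cdir p.2).1, (cpos p).2 + (cdir p.2).2)) from rfl, ← h] at hd'
      exact hd.not_swap hd'
    · have : cornerDart (v, k) = cornerDart p := by
        rw [show cornerDart p = (cpos p, ((cpos p).1 + (cdir p.2).1, (cpos p).2 + (cdir p.2).2)) from rfl]
        simp only [Prod.mk.injEq] at h
        exact Prod.ext h.2 h.1
      have hpk : (v, k) = p := cornerDart_injective this
      exact hv (by rw [show faceAt v k = cFace (v, k) from rfl, hpk]; exact hp)
  have : dwnd D (fcell (cFace (v, k))) - dwnd D (vcell v) = 0 := by rw [hjump, h1, h2]; simp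
  rw [show cFace (v, k) = faceAt v k from rfl] at this
  omega

/-- Along a chain of side-adjacent NON-inner faces a supported chain has constant winding count. -/
theorem dwnd_faceChain_ST {D : List (Pt × Pt)}
    (hsupp : ∀ d ∈ D, ∃ p : Site 2 × Fin 4, E.IsInnerFace (cFace p) ∧ (d = (cpos p, ((cpos p).1 + (cdir p.2).1, (cpos p).2 + (cdir p.2).2)) ∨ d = (((cpos p).1 + (cdir p.2).1, (cpos p).2 + (cdir p.2).2), cpos p)))
    (hK : ∀ g : Pt → ℤ, (D.map fun d => g d.2 - g d.1).sum = 0) :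
    ∀ (L : List (Site 2)) (f : Site 2), List.IsChain (fun g g' : Site 2 => (zdGraph 2).Adj g g') (f :: L) →
      (∀ g ∈ f :: L, ¬ E.IsInnerFace g) → dwnd D (fcell f) = dwnd D (fcell ((f :: L).getLast (List.cons_ne_nil _ _)))
  | [], f, _, _ => rfl
  | g :: L, f, hch, hout => by
    rw [List.isChain_cons_cons] at hch
    obtain ⟨hfg, hch'⟩ := hch
    obtain ⟨j, hj⟩ := Literature.Probability.LatticeModels.exists_eq_add_cornerUnit hfg
    -- the common vertex `v = f + cornerOff (j + 1)` of `f` and `g`: `faceAt v (j + 1) = f`, `faceAt v j = g`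
    set v : Site 2 := f + cornerOff (j + 1) with hv
    have hvf : faceAt v (j + 1) = f := by rw [hv, faceAt]; abel
    have hvg : faceAt v j = g := by
      rw [hj, hv, faceAt, cornerUnit_eq_off_sub]; abel
    have hf : ¬ E.IsInnerFace f := hout f List.mem_cons_self
    have hg : ¬ E.IsInnerFace g := hout g (List.mem_cons_of_mem _ List.mem_cons_self)
    have e1 := dwnd_vcell_eq_fcell_ST hsupp hK v (j + 1) (by rw [hvf]; exact hf)
    have e2 := dwnd_vcell_eq_fcell_ST hsupp hK v j (by rw [hvg]; exact hg)
    rw [hvf] at e1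
    rw [hvg] at e2
    have ih := dwnd_faceChain_ST hsupp hK L g hch' (fun g' hg' => hout g' (List.mem_cons_of_mem _ hg'))
    rw [← e1, e2, ih]
    rfl

end Supported

/-! ## The exterior winding lemma -/

/-- **Exterior winding lemma** (registered helper `ufrs_exteriorWinding_ST` of stmt-CriticalPhenomena-11387).
For an admissible datum `E` of the Jordan Dobrushin domain `D` and a CLOSED chain `Dl` of darts / reversed
darts of corners whose faces are inner for `E` (closedness: zero boundary against every test function),
the winding count `dwnd Dl` vanishes at the medial face `(f₀ + f₁, f₁ - f₀)` of every NON-inner face `f`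
and at the medial face `(v₀ + v₁ - 1, v₁ - v₀)` of every vertex `v` of a non-inner face `faceAt v k`. -/
theorem ufrs_exteriorWinding_ST : ∀ (D : DobrushinDomain) (E : DiscreteDobrushin), E.Ω = D.carrier → E.IsZdAdmissible → ∀ (Dl : List (MedialTrail.Pt × MedialTrail.Pt)), (∀ d ∈ Dl, ∃ p : Site 2 × Fin 4, E.IsInnerFace (cFace p) ∧ (d = (cpos p, ((cpos p).1 + (cdir p.2).1, (cpos p).2 + (cdir p.2).2)) ∨ d = (((cpos p).1 + (cdir p.2).1, (cpos p).2 + (cdir p.2).2), cpos p))) → (∀ g : MedialTrail.Pt → ℤ, (Dl.map fun d => g d.2 - g d.1).sum = 0) → (∀ f : Site 2, ¬ E.IsInnerFace f → MedialTrail.dwnd Dl (f 0 + f 1, f 1 - f 0) = 0) ∧ (∀ (v : Site 2) (k : Fin 4), ¬ E.IsInnerFace (faceAt v k) → MedialTrail.dwnd Dl (v 0 + v 1 - 1, v 1 - v 0) = 0) := by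
  intro D E hΩ hE Dl hsupp hK
  have hδ : 0 < E.δ := hE.delta_pos
  have hΩb : Bornology.IsBounded E.Ω := by rw [hΩ]; exact D.isBounded
  obtain ⟨Y₂, htop⟩ := exists_top_innerFaces_ST (E := E) hΩb hδ
  -- a bound for the rows of the chain
  obtain ⟨m, hm⟩ := exists_snd_bounds_SR Dl
  -- faces: climb to a high face in the same column
  have hface : ∀ f : Site 2, ¬ E.IsInnerFace f → dwnd Dl (fcell f) = 0 := by
    intro f hf
    -- the target face `f + N • e₁`, high in both coordinates systems
    obtain ⟨N, hN1, hN2⟩ : ∃ N : ℕ, Y₂ < f 1 + N ∧ m < f 1 + N - f 0 :=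
      ⟨(max (Y₂ - f 1) (m - f 1 + f 0)).toNat + 1, by push_cast; omega, by push_cast; omega⟩
    set g₁ : Site 2 := f + N • cornerUnit 1 with hg₁
    have hg₁c : g₁ 0 = f 0 ∧ g₁ 1 = f 1 + N := by
      rw [hg₁, add_nsmul_cornerUnit_apply, add_nsmul_cornerUnit_apply]; simp [cornerUnit]
    have hg₁out : ¬ E.IsInnerFace g₁ := fun h => by have := htop g₁ h; omega
    obtain ⟨L, hch, hout, hlast⟩ := exists_faceChain_ST D hΩ hE hf hg₁out
    rw [dwnd_faceChain_ST hsupp hK L f hch hout, hlast]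
    -- at the high face every dart is weakly below
    have hF2 : (fcell g₁).2 = f 1 + N - f 0 := by
      simp only [fcell, hg₁c.1, hg₁c.2]
    rw [dwnd, List.sum_eq_zero]
    intro a ha
    rw [List.mem_map] at ha
    obtain ⟨d, hd, rfl⟩ := ha
    have hb := hm d hd
    exact dartWnd_eq_zero_of_le d _ (by rw [hF2]; omega) (by rw [hF2]; omega)
  refine ⟨fun f hf => hface f hf, fun v k hv => ?_⟩
  have h := dwnd_vcell_eq_fcell_ST hsupp hK v k hv
  rw [vcell] at h
  rw [h]
  exact hface _ hv

/-! ## Medial coordinates under translation -/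

/-- The medial translation vector of the lattice shift `w`. -/
def mshift (w : Site 2) : MedialTrail.Pt := (w 0 + w 1, w 1 - w 0)

/-- Shifting a medial point back by `w`. -/
def unshift (w : Site 2) (P : MedialTrail.Pt) : MedialTrail.Pt := (P.1 - (mshift w).1, P.2 - (mshift w).2)

/-- `cpos` of a translated corner. -/
theorem cpos_add_ST (v w : Site 2) (k : Fin 4) : cpos (v + w, k) = ((cpos (v, k)).1 + (mshift w).1, (cpos (v, k)).2 + (mshift w).2) := by
  simp only [cpos, mshift, Pi.add_apply, Prod.mk.injEq]
  constructor <;> ring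

/-- Shifting back the `cpos` of a translated corner. -/
theorem unshift_cpos_ST (w : Site 2) (c : Site 2 × Fin 4) : unshift w (cpos c) = cpos (c.1 - w, c.2) := by
  obtain ⟨v, k⟩ := c
  have h := cpos_add_ST (v - w) w k
  rw [sub_add_cancel] at h
  rw [h, unshift]
  simp

/-- `unshift` is injective. -/
theorem unshift_injective_ST (w : Site 2) : Function.Injective (unshift w) := by
  intro P Q h
  simp only [unshift, Prod.mk.injEq] at h
  exact Prod.ext (by omega) (by omega)

/-- Turns are translation invariant. -/
theorem turn_unshift_ST (w : Site 2) (P Q R : Pt) : turn (unshift w P) (unshift w Q) (unshift w R) = turn P Q R := by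
  simp only [turn, unshift, sub_sub_sub_cancel_right]

/-- The face of a corner shifted back. -/
theorem cFace_sub_ST (c : Site 2 × Fin 4) (w : Site 2) : cFace (c.1 - w, c.2) = cFace c - w := by
  simp only [cFace, faceAt]; abel

/-! ## A closed trail from an arc and a closing path, dart version -/

/-- **The glued closed walk is a trail** (variant of `isTrail_glue_SR` with dart-distinctness of the
closing path instead of vertex-distinctness: the closing path may touch itself). -/
theorem isTrail_glue_darts_ST {P : ℕ → Pt} {n : ℕ} {K : ℕ → Pt} {M : ℕ}
    (hP : ∀ m ≤ n, IsDart (P m) (P (m + 1))) (hK : ∀ u < M, IsDart (K u) (K (u + 1)))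
    (hK0 : K 0 = P (n + 1)) (hKM : K M = P 0)
    (hPinj : ∀ m ≤ n, ∀ m' ≤ n, (P m, P (m + 1)) = (P m', P (m' + 1)) → m = m')
    (hKinj : ∀ u < M, ∀ u' < M, (K u, K (u + 1)) = (K u', K (u' + 1)) → u = u')
    (hsep : ∀ m ≤ n, ∀ u < M, (P m, P (m + 1)) ≠ (K u, K (u + 1))) :
    IsTrail ((List.range (n + (M + 1))).map (glueSeq P n K M)) := by
  have hper := glueSeq_period_SR hK0 hKM
  refine ⟨by simp, ?_, ?_⟩
  · rw [cdarts_map_range _ hper]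
    refine List.Nodup.map_on ?_ (List.nodup_range)
    intro m hm m' hm' hmm
    rw [List.mem_range] at hm hm'
    rcases glueSeq_dart_SR hK0 m hm with ⟨h1, e1⟩ | ⟨u, hu, rfl, e1⟩ <;>
    rcases glueSeq_dart_SR hK0 m' hm' with ⟨h2, e2⟩ | ⟨u', hu', rfl, e2⟩
    · exact hPinj m h1 m' h2 (by rw [← e1, ← e2, hmm])
    · exact absurd (by rw [← e1, ← e2, hmm]) (hsep m h1 u' hu')
    · exact absurd (by rw [← e1, ← e2, hmm]) (hsep m' h2 u hu)
    · have : u = u' := hKinj u hu u' hu' (by rw [← e1, ← e2, hmm])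
      rw [this]
  · rw [cdarts_map_range _ hper]
    intro d hd
    rw [List.mem_map] at hd
    obtain ⟨m, hm, rfl⟩ := hd
    rw [List.mem_range] at hm
    rcases glueSeq_dart_SR hK0 m hm with ⟨h1, e1⟩ | ⟨u, hu, rfl, e1⟩
    · rw [e1]; exact hP m h1
    · rw [e1]; exact hK u hu


/-- The dart of a corner, read through `unshift` on the translate: shifting back the coded step of the
corner `c` gives the dart of the corner `(c.1 - w, c.2)`. -/
theorem unshift_step_ST (w : Site 2) (β : BondConfig (Site 2)) (c : Site 2 × Fin 4) :
    (unshift w (cpos c), unshift w (cpos (nextCorner β c))) = cornerDart (c.1 - w, c.2) := by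
  rw [cornerDart, ← unshift_cpos_ST w c, cpos_nextCorner]
  refine Prod.ext rfl ?_
  simp only [unshift]
  exact Prod.ext (by ring) (by ring)

/-- A free step (left or right turn) is a coded dart: `(cpos c, cpos c') = cornerDart c`. -/
theorem freeStep_dart_ST {c c' : Site 2 × Fin 4}
    (h : c' = (c.1, c.2 + 1) ∨ c' = (c.1 + cornerUnit (c.2 + 1), c.2 + 3)) : (cpos c, cpos c') = cornerDart c := by
  classical
  rcases h with rfl | rfl
  · have e : ((c.1, c.2 + 1) : Site 2 × Fin 4) = nextCorner (∅ : Set (Sym2 (Site 2))) c :=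
      (nextCorner_of_not_mem (Set.notMem_empty _)).symm
    rw [e, ← cornerDart_eq]
  · have e : ((c.1 + cornerUnit (c.2 + 1), c.2 + 3) : Site 2 × Fin 4) = nextCorner (Set.univ : Set (Sym2 (Site 2))) c :=
      (nextCorner_of_mem (Set.mem_univ _)).symm
    rw [e, ← cornerDart_eq]


end

end Summit.CriticalPhenomena.CardyFormulaZ2.Cruxes.EdgePrecompact.QkzStripBoundaryArm
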